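import Summits.KontsevichZagierPeriods.KontsevichZagierPeriods.Theorems.TerasomaMultiplicationBetaCancellationDivisorSlicingDefs
import Literature.NumberTheory.Transcendental.KZLogCalculusProofs
import Literature.NumberTheory.Transcendental.SemialgebraicMapsProofs

/-!
# `BetaCancellation` (stmt-KontsevichZagierPeriods-13633), line `divisor-slicing-transshipment` — stub `stub_tameForm`, auxiliary file 3: null sets under piecewise substitutions

The two measure-theoretic tools behind composition and inversion of the finite piecewise measure
isomorphisms `MIso`:

* `volume_image_null_of_hasFDerivWithinAt` — the image of a null subset of `S` under a map with a
  derivative within `S` is null (Mathlib's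
  `MeasureTheory.addHaar_image_eq_zero_of_differentiableOn_of_addHaar_eq_zero`);
* `volume_inter_preimage_null` — for `Ψ` injective on `S` with a derivative `Ψ' z` within `S` of
  NON-ZERO determinant at every point of `S`, the part of `S` mapped into a null set is null: by the
  area formula `∫⁻_E |det Ψ'| = vol (Ψ E)` (`MeasureTheory.lintegral_abs_det_fderiv_eq_addHaar_image`)
  the Jacobian vanishes a.e. on `E = S ∩ Ψ⁻¹ T`, so `E` is null;

and the semialgebraic bookkeeping they need: preimages of `ℚ`-semialgebraic sets under
`ℚ`-semialgebraic maps are `ℚ`-semialgebraic (Tarski–Seidenberg), the inverse of an injective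
`ℚ`-semialgebraic map is a `ℚ`-semialgebraic map on the image, and a `ℚ`-semialgebraic map which is
smooth on an open set off a null `ℚ`-semialgebraic subset of its (semialgebraic) domain
(`KZ.exists_isOpen_contDiffOn` coordinatewise). Finally: the sign sets `{f > 0}`, `{f < 0}`, `{f = 0}`,
`{f < g}` of semialgebraic functions (in particular `posSet`, `negSet`) are `ℚ`-semialgebraic
(Tarski–Seidenberg).

References: J. Bochnak, M. Coste, M.-F. Roy, *Real Algebraic Geometry* (1998), §2.2, §2.9.
-/

noncomputable section

-- `Summit.KontsevichZagierPeriods.KontsevichZagierPeriods.…` is the tree's mandated layout (single-conjunct summit).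
set_option linter.dupNamespace false

namespace Summit.KontsevichZagierPeriods.KontsevichZagierPeriods.BetaCancellationDivisorSlicing

open MeasureTheory Set Filter MvPolynomial
open scoped Topology ContDiff
open Literature.NumberTheory.Transcendental
open Literature.NumberTheory.Transcendental.KZ
open Literature.ModelTheory.ExponentialFields (IsSemialgebraic isSemialgebraic_univ)

variable {N m : ℕ}

/-! ### Null sets -/

/-- The image of a null subset `E ⊆ S` under a map with a derivative within `S` at every point of
`S` is null. [folklore] -/
theorem volume_image_null_of_hasFDerivWithinAt {S E : Set (Fin N → ℝ)}
    {Ψ : (Fin N → ℝ) → (Fin N → ℝ)} {Ψ' : (Fin N → ℝ) → ((Fin N → ℝ) →L[ℝ] (Fin N → ℝ))}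
    (hΨ' : ∀ z ∈ S, HasFDerivWithinAt Ψ (Ψ' z) S z) (hES : E ⊆ S) (hE : volume E = 0) :
    volume (Ψ '' E) = 0 :=
  addHaar_image_eq_zero_of_differentiableOn_of_addHaar_eq_zero volume
    (fun z hz => ((hΨ' z (hES hz)).mono hES).differentiableWithinAt) hE

/-- From the measure-preservation identity `ρ z = θ (Ψ z) * |det Ψ' z|` with `0 < ρ z`: the
Jacobian determinant is non-zero and the target density is positive at the image point. [folklore] -/
theorem det_ne_zero_of_density {ρ θ : (Fin N → ℝ) → ℝ} {Ψ : (Fin N → ℝ) → (Fin N → ℝ)}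
    {A : (Fin N → ℝ) →L[ℝ] (Fin N → ℝ)} {z : Fin N → ℝ} (h : ρ z = θ (Ψ z) * |A.det|)
    (hρ : 0 < ρ z) : A.det ≠ 0 ∧ 0 < θ (Ψ z) := by
  rw [h] at hρ
  have habs : 0 ≤ |A.det| := abs_nonneg _
  constructor
  · intro h0
    rw [h0, abs_zero, mul_zero] at hρ
    exact lt_irrefl _ hρ
  · by_contra hθ
    push Not at hθ
    exact absurd hρ (not_lt.mpr (mul_nonpos_of_nonpos_of_nonneg hθ habs))

/-- **Preimages of null sets under non-degenerate substitutions are null.** If `Ψ` is injective on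
`S` with a derivative `Ψ' z` within `S` of non-zero determinant at every `z ∈ S`, `T` is null and
`S ∩ Ψ⁻¹ T` is measurable, then `S ∩ Ψ⁻¹ T` is null (area formula). [folklore] -/
theorem volume_inter_preimage_null {S T : Set (Fin N → ℝ)} {Ψ : (Fin N → ℝ) → (Fin N → ℝ)}
    {Ψ' : (Fin N → ℝ) → ((Fin N → ℝ) →L[ℝ] (Fin N → ℝ))}
    (hΨ' : ∀ z ∈ S, HasFDerivWithinAt Ψ (Ψ' z) S z) (hinj : InjOn Ψ S)
    (hdet : ∀ z ∈ S, (Ψ' z).det ≠ 0) (hE : MeasurableSet (S ∩ Ψ ⁻¹' T)) (hT : volume T = 0) :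
    volume (S ∩ Ψ ⁻¹' T) = 0 := by
  set E := S ∩ Ψ ⁻¹' T with hE_def
  have hES : E ⊆ S := inter_subset_left
  have hΨ'E : ∀ z ∈ E, HasFDerivWithinAt Ψ (Ψ' z) E z := fun z hz => (hΨ' z (hES hz)).mono hES
  have himg : volume (Ψ '' E) = 0 :=
    measure_mono_null (by rintro _ ⟨z, hz, rfl⟩; exact hz.2) hT
  have hlin : ∫⁻ z in E, ENNReal.ofReal |(Ψ' z).det| = 0 := by
    rw [lintegral_abs_det_fderiv_eq_addHaar_image volume hE hΨ'E (hinj.mono hES), himg]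
  have hae : ∀ᵐ z ∂(volume.restrict E), ENNReal.ofReal |(Ψ' z).det| = 0 :=
    (lintegral_eq_zero_iff' (aemeasurable_ofReal_abs_det_fderivWithin volume hE hΨ'E)).mp hlin
  have hae' : ∀ᵐ z ∂(volume.restrict E), z ∉ E := by
    filter_upwards [hae] with z hz hzE
    have h0 : |(Ψ' z).det| ≤ 0 := ENNReal.ofReal_eq_zero.mp hz
    exact hdet z (hES hzE) (abs_nonpos_iff.mp h0)
  rw [ae_restrict_iff' hE] at hae'
  exact measure_eq_zero_iff_ae_notMem.mpr (hae'.mono fun z hz hzE => hz hzE hzE)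

/-! ### Semialgebraic bookkeeping -/

section Semialgebraic

variable {S : Set (Fin m → ℝ)} {Ψ : (Fin m → ℝ) → (Fin N → ℝ)}

/-- **Preimages under semialgebraic maps.** If `Ψ` is a `ℚ`-semialgebraic map on `S` and `T` is
`ℚ`-semialgebraic then `{z ∈ S | Ψ z ∈ T}` is `ℚ`-semialgebraic: it is the projection to the first
factor of `graph Ψ|_S ∩ (ℝᵐ × T)` (Tarski–Seidenberg). [cite: BochnakCosteRoy1998, Prop. 2.2.7] -/
theorem isSemialgebraic_sep_preimage (hΨ : IsSemialgebraicMapOn ℚ S Ψ) {T : Set (Fin N → ℝ)}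
    (hT : IsSemialgebraic ℚ T) : IsSemialgebraic ℚ {z | z ∈ S ∧ Ψ z ∈ T} := by
  have hW : IsSemialgebraic ℚ ({w : Fin (m + N) → ℝ | ∃ x ∈ S, w = Fin.append x (Ψ x)} ∩
      (fun w : Fin (m + N) → ℝ => w ∘ Fin.natAdd m) ⁻¹' T) :=
    Literature.ModelTheory.ExponentialFields.IsSemialgebraic.inter hΨ (hT.preimage_comp (Fin.natAdd m))
  convert hW.image_comp (Fin.castAdd N) using 1
  ext x
  simp only [mem_setOf_eq, mem_image, mem_inter_iff, mem_preimage]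
  constructor
  · rintro ⟨hx, hxT⟩
    refine ⟨Fin.append x (Ψ x), ⟨⟨x, hx, rfl⟩, ?_⟩, ?_⟩
    · convert hxT using 1
      funext j
      simp
    · funext i
      simp
  · rintro ⟨w, ⟨⟨y, hy, rfl⟩, hwT⟩, rfl⟩
    have h1 : (Fin.append y (Ψ y) ∘ Fin.castAdd N) = y := by
      funext i
      simp
    have h2 : (Fin.append y (Ψ y) ∘ Fin.natAdd m) = Ψ y := by
      funext j
      simp
    rw [h1]
    rw [h2] at hwT
    exact ⟨hy, hwT⟩

/-- The preimage piece `S ∩ Ψ⁻¹ T` is `ℚ`-semialgebraic. [cite: BochnakCosteRoy1998, Prop. 2.2.7] -/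
theorem isSemialgebraic_inter_preimage (hΨ : IsSemialgebraicMapOn ℚ S Ψ) {T : Set (Fin N → ℝ)}
    (hT : IsSemialgebraic ℚ T) : IsSemialgebraic ℚ (S ∩ Ψ ⁻¹' T) :=
  isSemialgebraic_sep_preimage hΨ hT

end Semialgebraic

section Inverse

variable {S : Set (Fin N → ℝ)} {Ψ : (Fin N → ℝ) → (Fin N → ℝ)}

/-- The block swap `(x, y) ↦ (y, x)` of coordinates of `ℝᴺ⁺ᴺ`. [folklore] -/
theorem append_comp_swap (x y : Fin N → ℝ) :
    (Fin.append x y ∘ fun i : Fin (N + N) => Fin.addCases (fun a => Fin.natAdd N a)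
      (fun b => Fin.castAdd N b) i) = Fin.append y x := by
  funext i
  refine Fin.addCases (fun a => ?_) (fun b => ?_) i
  · rw [Function.comp_apply, Fin.addCases_left, Fin.append_right, Fin.append_left]
  · rw [Function.comp_apply, Fin.addCases_right, Fin.append_left, Fin.append_right]

/-- **The inverse of an injective semialgebraic map is semialgebraic on the image**: its graph is
the block swap of the graph. [cite: BochnakCosteRoy1998, Prop. 2.2.7] -/
theorem isSemialgebraicMapOn_invFunOn_image (hΨ : IsSemialgebraicMapOn ℚ S Ψ) (hinj : InjOn Ψ S) :
    IsSemialgebraicMapOn ℚ (Ψ '' S) (Function.invFunOn Ψ S) := by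
  have hne : ∀ x ∈ S, Function.invFunOn Ψ S (Ψ x) = x := fun x hx => hinj.leftInvOn_invFunOn hx
  unfold IsSemialgebraicMapOn
  convert hΨ.image_comp (fun i : Fin (N + N) => Fin.addCases (fun a => Fin.natAdd N a)
      (fun b => Fin.castAdd N b) i) using 1
  ext w
  simp only [mem_setOf_eq, mem_image]
  constructor
  · rintro ⟨y, ⟨x, hx, rfl⟩, rfl⟩
    exact ⟨Fin.append x (Ψ x), ⟨x, hx, rfl⟩, by rw [append_comp_swap, hne x hx]⟩
  · rintro ⟨w', ⟨x, hx, rfl⟩, rfl⟩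
    exact ⟨Ψ x, ⟨x, hx, rfl⟩, by rw [append_comp_swap, hne x hx]⟩

end Inverse

/-! ### Smooth locus of a semialgebraic map -/

/-- **A `ℚ`-semialgebraic map is smooth on an open `ℚ`-semialgebraic subset of its domain with null
`ℚ`-semialgebraic complement** (apply `KZ.exists_isOpen_contDiffOn` to each coordinate and intersect).
[cite: BochnakCosteRoy1998, §2.9] -/
theorem exists_isOpen_contDiffOn_map {D : Set (Fin N → ℝ)} {g : (Fin N → ℝ) → (Fin m → ℝ)}
    (hD : IsSemialgebraic ℚ D) (hg : IsSemialgebraicMapOn ℚ D g) :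
    ∃ G : Set (Fin N → ℝ), G ⊆ D ∧ IsOpen G ∧ IsSemialgebraic ℚ G ∧
      (∀ y ∈ G, ContDiffAt ℝ ∞ g y) ∧ IsSemialgebraic ℚ (D \ G) ∧ volume (D \ G) = 0 := by
  classical
  have hgc : ∀ c : Fin m, IsSemialgebraicFunOn ℚ D (fun y => g y c) :=
    (isSemialgebraicMapOn_iff_forall_holds hD).mp hg
  choose G hGD hGo hGsa hGsm hGdiff hGnull using fun c => exists_isOpen_contDiffOn hD (hgc c)
  have hD₀ : IsSemialgebraic ℚ (interior D) :=
    Literature.ModelTheory.ExponentialFields.isSemialgebraic_interior hD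
  refine ⟨interior D ∩ ⋂ c, G c, fun y hy => interior_subset hy.1,
    isOpen_interior.inter (isOpen_iInter_of_finite fun c => hGo c), ?_, ?_, hD.diff ?_, ?_⟩
  · have : (⋂ c, G c) = ⋂ c ∈ (Finset.univ : Finset (Fin m)), G c := by
      ext y
      simp
    rw [this]
    exact hD₀.inter (Literature.ModelTheory.ExponentialFields.IsSemialgebraic.biInter _ _
      fun c _ => hGsa c)
  · intro y hy
    rw [contDiffAt_pi]
    intro c
    exact (hGsm c).contDiffAt ((hGo c).mem_nhds (mem_iInter.mp hy.2 c))
  · have : (⋂ c, G c) = ⋂ c ∈ (Finset.univ : Finset (Fin m)), G c := by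
      ext y
      simp
    rw [this]
    exact hD₀.inter (Literature.ModelTheory.ExponentialFields.IsSemialgebraic.biInter _ _
      fun c _ => hGsa c)
  · have hsub : D \ (interior D ∩ ⋂ c, G c) ⊆ frontier D ∪ ⋃ c, (D \ G c) := by
      intro y hy
      by_cases hyi : y ∈ interior D
      · have : ¬ ∀ c, y ∈ G c := fun h => hy.2 ⟨hyi, mem_iInter.mpr h⟩
        push Not at this
        obtain ⟨c, hc⟩ := this
        exact Or.inr (mem_iUnion.mpr ⟨c, hy.1, hc⟩)
      · exact Or.inl ⟨subset_closure hy.1, hyi⟩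
    exact measure_mono_null hsub (measure_union_null (volume_frontier_eq_zero_of_isSemialgebraic hD)
      ((measure_iUnion_null_iff).mpr hGnull))

/-! ### Sign sets -/

section SignSets

variable {n : ℕ}

section Sign

variable {s : Set (Fin n → ℝ)} {f : (Fin n → ℝ) → ℝ}

/-- The positivity set `{x ∈ s | 0 < f x}` of a real `ℚ`-semialgebraic function is
`ℚ`-semialgebraic (graph elimination; Tarski–Seidenberg). [cite: BochnakCosteRoy1998, Thm. 2.2.1] -/
theorem isSemialgebraic_sep_pos (hf : IsSemialgebraicFunOn ℚ s f) :
    IsSemialgebraic ℚ {x | x ∈ s ∧ 0 < f x} := by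
  have hT : IsSemialgebraic ℚ {z : Fin (n + 1) → ℝ | 0 < z (Fin.last n)} := by
    simpa using Literature.ModelTheory.ExponentialFields.isSemialgebraic_setOf_eval_pos
      (k := ℚ) (R := ℝ) (X (Fin.last n) : MvPolynomial (Fin (n + 1)) ℚ)
  convert hf.isSemialgebraic_sep_snoc_mem
    Literature.ModelTheory.ExponentialFields.tarski_seidenberg_real_holds hT using 1
  ext x
  simp

/-- The negativity set `{x ∈ s | f x < 0}` of a real `ℚ`-semialgebraic function is
`ℚ`-semialgebraic. [cite: BochnakCosteRoy1998, Thm. 2.2.1] -/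
theorem isSemialgebraic_sep_neg (hf : IsSemialgebraicFunOn ℚ s f) :
    IsSemialgebraic ℚ {x | x ∈ s ∧ f x < 0} := by
  convert isSemialgebraic_sep_pos hf.neg using 1
  ext x
  simp

/-- The zero set `{x ∈ s | f x = 0}` of a real `ℚ`-semialgebraic function is `ℚ`-semialgebraic.
[cite: BochnakCosteRoy1998, Thm. 2.2.1] -/
theorem isSemialgebraic_sep_zero (hf : IsSemialgebraicFunOn ℚ s f) :
    IsSemialgebraic ℚ {x | x ∈ s ∧ f x = 0} := by
  have hT : IsSemialgebraic ℚ {z : Fin (n + 1) → ℝ | z (Fin.last n) = 0} := by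
    simpa using Literature.ModelTheory.ExponentialFields.isSemialgebraic_setOf_eval_eq_zero
      (k := ℚ) (R := ℝ) (X (Fin.last n) : MvPolynomial (Fin (n + 1)) ℚ)
  convert hf.isSemialgebraic_sep_snoc_mem
    Literature.ModelTheory.ExponentialFields.tarski_seidenberg_real_holds hT using 1
  ext x
  simp

/-- The comparison set `{x ∈ s | f x < g x}` of two real `ℚ`-semialgebraic functions is
`ℚ`-semialgebraic. [cite: BochnakCosteRoy1998, Thm. 2.2.1] -/
theorem isSemialgebraic_sep_lt' {g : (Fin n → ℝ) → ℝ} (hf : IsSemialgebraicFunOn ℚ s f)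
    (hg : IsSemialgebraicFunOn ℚ s g) : IsSemialgebraic ℚ {x | x ∈ s ∧ f x < g x} := by
  convert isSemialgebraic_sep_pos (IsSemialgebraicFunOn.sub_holds hg hf) using 1
  ext x
  simp [sub_pos]

end Sign

/-- The positive part of the domain of an integral representation is `ℚ`-semialgebraic.
[cite: BochnakCosteRoy1998, Thm. 2.2.1] -/
theorem isSemialgebraic_posSet (r : IntegralRep n) : IsSemialgebraic ℚ (posSet r) :=
  isSemialgebraic_sep_pos r.isSemialgebraicFunOn_integrand

/-- The negative part of the domain of an integral representation is `ℚ`-semialgebraic.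
[cite: BochnakCosteRoy1998, Thm. 2.2.1] -/
theorem isSemialgebraic_negSet (r : IntegralRep n) : IsSemialgebraic ℚ (negSet r) :=
  isSemialgebraic_sep_neg r.isSemialgebraicFunOn_integrand

/-- The positive part lies in the domain. [folklore] -/
theorem posSet_subset (r : IntegralRep n) : posSet r ⊆ r.domain := fun _ hx => hx.1

/-- The negative part lies in the domain. [folklore] -/
theorem negSet_subset (r : IntegralRep n) : negSet r ⊆ r.domain := fun _ hx => hx.1

/-- Membership in the positive part. [folklore] -/
theorem mem_posSet {r : IntegralRep n} {x : Fin n → ℝ} : x ∈ posSet r ↔ x ∈ r.domain ∧ 0 < r.integrand x :=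
  Iff.rfl

/-- Membership in the negative part. [folklore] -/
theorem mem_negSet {r : IntegralRep n} {x : Fin n → ℝ} : x ∈ negSet r ↔ x ∈ r.domain ∧ r.integrand x < 0 :=
  Iff.rfl

/-- The positive part of the negative representation is the negative part. [folklore] -/
@[simp] theorem posSet_neg (r : IntegralRep n) : posSet r.neg = negSet r := by
  ext x
  simp [mem_posSet, mem_negSet]

/-- The negative part of the negative representation is the positive part. [folklore] -/
@[simp] theorem negSet_neg (r : IntegralRep n) : negSet r.neg = posSet r := by
  ext x
  simp [mem_posSet, mem_negSet]

/-- The stabilised integrand is positive on the stabilised positive part. [folklore] -/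
theorem stabFun_pos_of_mem (h : n ≤ N) (r : IntegralRep n) {z : Fin N → ℝ}
    (hz : z ∈ stabSet h (posSet r)) : 0 < stabFun h r.integrand z :=
  hz.1.2

/-- The negated stabilised integrand is positive on the stabilised negative part. [folklore] -/
theorem stabFun_neg_pos_of_mem (h : n ≤ N) (r : IntegralRep n) {z : Fin N → ℝ}
    (hz : z ∈ stabSet h (negSet r)) : 0 < stabFun h (-r.integrand) z := by
  have := hz.1.2
  simp only [stabFun_apply, Pi.neg_apply, Left.neg_pos_iff]
  exact this

end SignSets

/-! ### Headline -/

/-- Registered helper goal of the stub `stub_tameForm`: preimages of null sets under injective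
substitutions with nowhere-vanishing Jacobian determinant are null. [folklore] -/
theorem tameForm_aux_preimageNull : ∀ {N : ℕ} {S T : Set (Fin N → ℝ)} {Ψ : (Fin N → ℝ) → (Fin N → ℝ)} {Ψ' : (Fin N → ℝ) → ((Fin N → ℝ) →L[ℝ] (Fin N → ℝ))}, (∀ z ∈ S, HasFDerivWithinAt Ψ (Ψ' z) S z) → Set.InjOn Ψ S → (∀ z ∈ S, (Ψ' z).det ≠ 0) → MeasurableSet (S ∩ Ψ ⁻¹' T) → volume T = 0 → volume (S ∩ Ψ ⁻¹' T) = 0 :=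
  fun hΨ' hinj hdet hE hT => volume_inter_preimage_null hΨ' hinj hdet hE hT

end Summit.KontsevichZagierPeriods.KontsevichZagierPeriods.BetaCancellationDivisorSlicing

end
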